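/-
Copyright (c) 2026 the pub-hodgecm-mathlib formalisation cell (harness21).  Prover seat hodgecm-mathlib-LH4-p09 (g2), req620 Track A «(D-RAM) FOUR-FRAME» squad
(unit U3_Laws, K-ABS-R road: second seat to F0P3-p01 (g30), dealer WORD #44).  The κ-TWIN of ★ p855115 (LH4-p10 (g0), `F0P3cDyRamStableSumSignClasses`).  2026-09-03.
-/
import Summits.HodgeConjecture.HodgeConjecture.Theorems.F0P3cDyRamStableSumSignClasses   -- ★ p855115: `ncard_fixed_signClass_eq_compl`, `sum_signClasses_eq_sum_add_sum`, `exists_rep_of_dichotomy`; brings ★ p855032 transport, ★ #0a tokens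
import HarnessLib

/-!
# Crux `H413`, line LH4 «(D-RAM) FOUR-FRAME» road — unit U3_Laws, TIER 2 SUPPORT: THE κ-WEIGHTED EIGHTFOLD SYMMETRISATION OF THE FOUR-FRAME SUM
# `2 · Σ_b κ_i(b) · n_t(Γ_b) = Σ_{s : (ℤ∕2)³} χ_i(s) · C_t(s)` with the COMPLEMENT-INVARIANT characters `χ_i` (step (2b) of a frame-free reduction of the κ-AMPLITUDE LAW)

Cell `hodgecm-mathlib` (D-0151), FLOOR 0, crux item H413 = `stmt-HodgeConjecture-24833`, route of record `HCCMUnconditional`; squad F0∕P3c∕LH4 (req618∕req620).  THEOREMS ONLY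
(no `def`, no instance, no notation, no `sorry`, default heartbeats); lane `--supports stmt-HodgeConjecture-24833 --as helper` (count-neutral).  Serves the κ-amplitude stub
`stub_U3_kappaAbsLawR` (tree `Cruxes/H413/Lines/F0_P3c_DyRamFourFrame_U3_Laws.lean` ED. 5 §K-R; first seat F0P3-p01 (g30), second seat LH4-p09 (g2)) exactly as ★ p855115 serves
the stable stubs: it is the κ-weighted twin of `two_mul_sum_fixedVertexCount_eq_sum_signClasses`, with the SAME hypotheses.

WHAT IS PROVED.  Setting of ★ p855115: the datum clauses (`σ` an isometric involution, `|ϖ| = exp(−1)`, non-zero `σ`-fixed elements of even valuation), `c` a `σ`-fixed unit with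
the index-two dichotomy, `f` a four-frame family (★ #0a H7), `T = diag(α, β, 1)`, `Γ_b = frameElt σ f b α β` (H8), `h_s = diag(d_s)` (`d_s j = c` if `s j` else `1`) for
`s : Fin 3 → Bool`, `C_t(s) = #{M : M a type-t vertex lattice of (K³, h_s), T·M = M}`, and `ω = ω(−1) = normSign σ (−1) ∈ {±1}`.  With the κ-weights `κ_i(b)` of ★ #0a H5
(`κ₀ = ε₁`, `κ₁ = ε₂`, `κ₂ = ε₁ε₂` at frame `b`, `(ε₁, ε₂) = signPair b`) and the characters of `(ℤ∕2)³` THROUGH THE TWO OTHER COORDINATES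
  `χ₀(s) = ω·(−1)^{[s 1]+[s 2]}`,  `χ₁(s) = ω·(−1)^{[s 0]+[s 2]}`,  `χ₂(s) = (−1)^{[s 0]+[s 1]}`   (spelled as an explicit `![…]` of `if`-signs, no definition),
for every slot `i` and every vertex type `t`:

  `2 · Σ_{b : Fin 4} κ_i(b) · fixedVertexCount σ ϖ t Γ_b = Σ_{s : Fin 3 → Bool} χ_i(s) · C_t(s)`     (`two_mul_sum_kappaChar_mul_fixedVertexCount_eq_sum_signClasses`, in `ℤ`).

So the κ-weighted four-frame sum — the left side of the κ-AMPLITUDE LAW (K-ABS) of ★ №1 ∕ №1-R `KappaAmplitudeLawAt(S∕R)` and of the κ-SIGN LAW — is HALF a signed sum of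
diagonal-model counts over all eight sign classes, a FRAME-FREE quantity; (K-ABS) at a datum thus reduces, like (S) did under (R-17), to NI2 (★) plus a frame-free «κ-MODEL SUM
LAW» `|Σ_s χ_i(s)·C_t(s)| = 2·ampl(q, k, B)` — which stays the census (a PROVER TARGET; nothing about it is claimed here).

THE MATHEMATICS.  (A) ★ p855032 + the dichotomy: `n_t(Γ_b) = C_t(s(b))` with `s(b) = (ε₁ = −1, ε₂ = −1, ω·ε₁ε₂ = −1)` (as in ★ p855115, re-derived here since that step is
internal to its head).  (B) ★ `ncard_fixed_signClass_eq_compl`: `C_t(s) = C_t(¬s)`.  (C) THE POINT: `κ_i(b)` is NOT a function of the single coordinate `s(b)_i` compatible with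
complementation, but `ε₁ = ω·(−1)^{s₁+s₂}`, `ε₂ = ω·(−1)^{s₀+s₂}`, `ε₁ε₂ = (−1)^{s₀+s₁}` on `s = s(b)` — and these products of TWO coordinate signs are complement-invariant; so
`κ_i(b) = χ_i(s(b)) = χ_i(¬s(b))` (a finite check, `kappaChar_eq_chi_signClass`), and ★ `sum_signClasses_eq_sum_add_sum` (the bijection `b ↦ s(b)`, `b ↦ ¬s(b)` onto
`(ℤ∕2)³`) gives `2·Σ_b κ_i(b) C(s(b)) = Σ_b χ_i(s b) C(s b) + Σ_b χ_i(¬s b) C(¬s b) = Σ_s χ_i(s) C(s)`.  [Rogawski1990 §4.9 p. 55 (the κ-orbital integral as a signed fixed-point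
count over the classes in the stable class); LanglandsShelstad1987 §1.3 (`κ` a character of `𝔇(T) ⊂ H¹(F, T)`).]
* §1 `kappaChar_eq_chi_signClass` (the finite identity, both values of `ω`).  §2 the head.
HONEST LABEL.  Count-neutral (`--supports`); nothing printed is asserted; the κ-laws stay PROVER TARGETS (risk line of record: t-free token pinned at d ∈ {2,3,4,5}; K-SGN sign
factor = TW4); the verdict of record for (D-RAM) stays PRINT [LanglandsShelstad1989 Thm. p. 484 ∕ Rogawski1990 Prop. 4.9.1 (a)] ∕ XL; `HC_CM` is proved only modulo the 7 printed
citations (2 remaining named inputs: hLiu418 = `stmt-HodgeConjecture-24832`, h413 = `stmt-HodgeConjecture-24833`) until rung 0 closes.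

## References
* [Rogawski1990] J. D. Rogawski, *Automorphic Representations of Unitary Groups in Three Variables*, Ann. of Math. Stud. 123 (1990), §3.6 pp. 28–29, §4.9 Prop. 4.9.1 (a) p. 55.
* [LanglandsShelstad1987] R. P. Langlands, D. Shelstad, *On the definition of transfer factors*, Math. Ann. 278 (1987), §1.3.
* [Jacobowitz1962] R. Jacobowitz, *Hermitian forms over local fields*, Amer. J. Math. 84 (1962), §4.
* [Kottwitz1986BaseChangeUnits] R. E. Kottwitz, *Base change for unit elements of Hecke algebras*, Compositio Math. 60 (1986), §1 pp. 240–241.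
-/

set_option autoImplicit false

noncomputable section

namespace Summit.HodgeConjecture.HodgeConjecture.Cruxes.H413.F0P3cDyRamKappaSumSignClasses

open Matrix
open Literature.NumberTheory.Automorphic Literature.NumberTheory.Automorphic.HermitianLattice Literature.NumberTheory.Automorphic.UnitaryGroup
open Literature.NumberTheory.Automorphic.UnitaryLatticeTree Literature.NumberTheory.Automorphic.UnitaryThreeFourFrame
open Summit.HodgeConjecture.HodgeConjecture.Cruxes.H413.F0P3cDyRamFixedCountDiagonalModel
open Summit.HodgeConjecture.HodgeConjecture.Cruxes.H413.F0P3cDyRamStableSumSignClasses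
open scoped Valued WithZero Matrix MatrixGroups

/-! ## §1  The κ-weights through two coordinates of the sign class: `κ_i(b) = χ_i(s(b)) = χ_i(¬s(b))` -/

/-- **`κ_i(b) = χ_i(s_ω(b))` AND `= χ_i(¬s_ω(b))`** for the sign vector `s_ω(b) = (ε₁(b) = −1, ε₂(b) = −1, (ε₁ε₂)(b) = −1 XOR ω)` of ★ p855115 (`ω = true` iff `ω(−1) = −1`,
`w = ∓1` its integer value) and the complement-invariant characters `χ₀(s) = w·(−1)^{[s 1]+[s 2]}`, `χ₁(s) = w·(−1)^{[s 0]+[s 2]}`, `χ₂(s) = (−1)^{[s 0]+[s 1]}` — a finite check over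
`ω`, `i`, `b`. [cite: LanglandsShelstad1987, §1.3] [cite: Rogawski1990, §4.9 p. 55] -/
theorem kappaChar_eq_chi_signClass (ω : Bool) (i : Fin 3) (b : Fin 4) :
    (kappaChar i b =
      (![(if (![(![false, false, true, true] : Fin 4 → Bool) b, (![false, true, false, true] : Fin 4 → Bool) b,
              xor ((![false, true, true, false] : Fin 4 → Bool) b) ω] : Fin 3 → Bool) 1 then -1 else 1) *
            (if (![(![false, false, true, true] : Fin 4 → Bool) b, (![false, true, false, true] : Fin 4 → Bool) b,
              xor ((![false, true, true, false] : Fin 4 → Bool) b) ω] : Fin 3 → Bool) 2 then -1 else 1) * (if ω then -1 else 1),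
          (if (![(![false, false, true, true] : Fin 4 → Bool) b, (![false, true, false, true] : Fin 4 → Bool) b,
              xor ((![false, true, true, false] : Fin 4 → Bool) b) ω] : Fin 3 → Bool) 0 then -1 else 1) *
            (if (![(![false, false, true, true] : Fin 4 → Bool) b, (![false, true, false, true] : Fin 4 → Bool) b,
              xor ((![false, true, true, false] : Fin 4 → Bool) b) ω] : Fin 3 → Bool) 2 then -1 else 1) * (if ω then -1 else 1),
          (if (![(![false, false, true, true] : Fin 4 → Bool) b, (![false, true, false, true] : Fin 4 → Bool) b,
              xor ((![false, true, true, false] : Fin 4 → Bool) b) ω] : Fin 3 → Bool) 0 then -1 else 1) *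
            (if (![(![false, false, true, true] : Fin 4 → Bool) b, (![false, true, false, true] : Fin 4 → Bool) b,
              xor ((![false, true, true, false] : Fin 4 → Bool) b) ω] : Fin 3 → Bool) 1 then -1 else 1)] : Fin 3 → ℤ) i) ∧
    (kappaChar i b =
      (![(if !((![(![false, false, true, true] : Fin 4 → Bool) b, (![false, true, false, true] : Fin 4 → Bool) b,
              xor ((![false, true, true, false] : Fin 4 → Bool) b) ω] : Fin 3 → Bool) 1) then -1 else 1) *
            (if !((![(![false, false, true, true] : Fin 4 → Bool) b, (![false, true, false, true] : Fin 4 → Bool) b,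
              xor ((![false, true, true, false] : Fin 4 → Bool) b) ω] : Fin 3 → Bool) 2) then -1 else 1) * (if ω then -1 else 1),
          (if !((![(![false, false, true, true] : Fin 4 → Bool) b, (![false, true, false, true] : Fin 4 → Bool) b,
              xor ((![false, true, true, false] : Fin 4 → Bool) b) ω] : Fin 3 → Bool) 0) then -1 else 1) *
            (if !((![(![false, false, true, true] : Fin 4 → Bool) b, (![false, true, false, true] : Fin 4 → Bool) b,
              xor ((![false, true, true, false] : Fin 4 → Bool) b) ω] : Fin 3 → Bool) 2) then -1 else 1) * (if ω then -1 else 1),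
          (if !((![(![false, false, true, true] : Fin 4 → Bool) b, (![false, true, false, true] : Fin 4 → Bool) b,
              xor ((![false, true, true, false] : Fin 4 → Bool) b) ω] : Fin 3 → Bool) 0) then -1 else 1) *
            (if !((![(![false, false, true, true] : Fin 4 → Bool) b, (![false, true, false, true] : Fin 4 → Bool) b,
              xor ((![false, true, true, false] : Fin 4 → Bool) b) ω] : Fin 3 → Bool) 1) then -1 else 1)] : Fin 3 → ℤ) i) := by
  cases ω <;> fin_cases i <;> fin_cases b <;> simp [kappaChar, signPair]

/-! ## §2  The head: the κ-weighted eightfold symmetrisation -/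

section Head

variable {K : Type} [Field K] [Valued K ℤᵐ⁰] {σ : K →+* K} {ϖ : K}

/-- **HEAD — THE κ-WEIGHTED EIGHTFOLD SYMMETRISATION OF THE FOUR-FRAME SUM, BOTH VERTEX TYPES, EVERY SLOT `i`.**  Under the datum clauses, with `c` a `σ`-fixed unit satisfying
the index-two dichotomy, for a four-frame family `f`, the diagonal literal `T = diag(α, β, 1)`, the frame elements `Γ_b = frameElt σ f b α β` and `w = normSign σ (−1)`:
`2 · Σ_b κ_i(b) · fixedVertexCount σ ϖ t Γ_b = Σ_{s : Fin 3 → Bool} χ_i(s) · #{M : M a type-t vertex lattice of (K³, diag(d_s)), T·M = M}`, `d_s j = c` if `s j` else `1`,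
`χ₀(s) = w·(−1)^{[s 1]+[s 2]}`, `χ₁(s) = w·(−1)^{[s 0]+[s 2]}`, `χ₂(s) = (−1)^{[s 0]+[s 1]}` — the κ-weighted four-frame sum is half a SIGNED sum of the diagonal-model counts over
all eight sign classes `(F^× ∕ N E^×)³`.  (κ-twin of ★ `two_mul_sum_fixedVertexCount_eq_sum_signClasses`; same hypotheses.)
[cite: Rogawski1990, §3.6 pp. 28–29; §4.9 Prop. 4.9.1 (a) p. 55] [cite: LanglandsShelstad1987, §1.3] [cite: Jacobowitz1962, §4] [cite: Kottwitz1986BaseChangeUnits, §1 pp. 240–241] -/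
theorem two_mul_sum_kappaChar_mul_fixedVertexCount_eq_sum_signClasses (hσ : ∀ x, σ (σ x) = x) (hvσ : ∀ a, Valued.v (σ a) = Valued.v a)
    (hϖ : Valued.v ϖ = WithZero.exp (-1 : ℤ)) (heven : ∀ x : K, σ x = x → x ≠ 0 → ∃ n : ℤ, Valued.v x = WithZero.exp (2 * n))
    {c : K} (hσc : σ c = c) (hvc : Valued.v c = 1)
    (hdich : ∀ x : K, σ x = x → x ≠ 0 → (∃ z : K, z * σ z = x) ∨ ∃ z : K, z * σ z = c * x)
    {f : Fin 4 → Fin 3 → (Fin 3 → K)} (hf : IsFourFrameFamily σ f) (α β : K)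
    (T : GL (Fin 3) K) (hT : (T : Matrix (Fin 3) (Fin 3) K) = Matrix.diagonal ![α, β, 1])
    (Γ : Fin 4 → GL (Fin 3) K) (hΓ : ∀ b, (Γ b : Matrix (Fin 3) (Fin 3) K) = frameElt σ f b α β) (t : ℕ) (i : Fin 3) :
    2 * ∑ b : Fin 4, kappaChar i b * (fixedVertexCount σ ϖ t (Γ b) : ℤ) =
      ∑ s : Fin 3 → Bool,
        (![(if s 1 then -1 else 1) * (if s 2 then -1 else 1) * normSign σ (-1),
           (if s 0 then -1 else 1) * (if s 2 then -1 else 1) * normSign σ (-1),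
           (if s 0 then -1 else 1) * (if s 1 then -1 else 1)] : Fin 3 → ℤ) i *
        ({M : Submodule 𝒪[K] (Fin 3 → K) |
          IsVertexLattice σ ϖ (Matrix.diagonal fun j => if s j then c else (1 : K)) t M ∧ mapGL T M = M}.ncard : ℤ) := by
  classical
  have hc0 : c ≠ 0 := fun h => by rw [h, map_zero] at hvc; exact zero_ne_one hvc
  -- the sign table of ★ p855115: `ω = true` iff `ω(−1) = −1`
  set ω : Bool := decide (normSign σ (-1 : K) = -1) with hω_def
  have hw : normSign σ (-1 : K) = if ω then -1 else 1 := by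
    rcases normSign_eq_one_or σ (-1 : K) with hp | hm
    · have hωf : ω = false := by rw [hω_def, decide_eq_false_iff_not, hp]; norm_num
      rw [hp, hωf]; rfl
    · have hωt : ω = true := by rw [hω_def, decide_eq_true_eq, hm]
      rw [hm, hωt]; rfl
  let e1 : Fin 4 → Bool := ![false, false, true, true]
  let e2 : Fin 4 → Bool := ![false, true, false, true]
  let e12 : Fin 4 → Bool := ![false, true, true, false]
  let sb : Fin 4 → Fin 3 → Bool := fun b => ![e1 b, e2 b, xor (e12 b) ω]
  let C : (Fin 3 → Bool) → ℕ := fun s =>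
    {M : Submodule 𝒪[K] (Fin 3 → K) | IsVertexLattice σ ϖ (Matrix.diagonal fun j => if s j then c else (1 : K)) t M ∧ mapGL T M = M}.ncard
  let χ : (Fin 3 → Bool) → ℤ := fun s =>
    (![(if s 1 then -1 else 1) * (if s 2 then -1 else 1) * normSign σ (-1),
       (if s 0 then -1 else 1) * (if s 2 then -1 else 1) * normSign σ (-1),
       (if s 0 then -1 else 1) * (if s 1 then -1 else 1)] : Fin 3 → ℤ) i
  -- (A) each frame is counted by its sign class (as in ★ p855115, whose step (A) is internal to its head)
  have hA : ∀ b : Fin 4, fixedVertexCount σ ϖ t (Γ b) = C (sb b) := by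
    intro b
    obtain ⟨d, hd1, hσd, hcls, hcount⟩ := fixedVertexCount_frameElt_eq_ncard_diagonal_model hσ hvσ hϖ heven hf b
    rw [hcount α β T (Γ b) hT (hΓ b) t]
    obtain ⟨-, -, h0, h1, h2⟩ := hf b
    have hd0 : ∀ j, d j ≠ 0 := fun j h => by
      have := hd1 j; rw [h, map_zero] at this; exact zero_ne_one this
    have hsign : ∀ j : Fin 3, (normSign σ (d j) = -1 ↔ sb b j = true) := by
      have hωcases := normSign_eq_one_or σ (-1 : K)
      intro j
      fin_cases j
      · change normSign σ (d 0) = -1 ↔ e1 b = true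
        rw [hcls 0, h0]
        fin_cases b <;> simp [e1, signPair]
      · change normSign σ (d 1) = -1 ↔ e2 b = true
        rw [hcls 1, h1]
        fin_cases b <;> simp [e2, signPair]
      · change normSign σ (d 2) = -1 ↔ xor (e12 b) ω = true
        rw [hcls 2, h2]
        rcases hωcases with hp | hm
        · have hωf : ω = false := by
            rw [hω_def, decide_eq_false_iff_not, hp]; norm_num
          rw [hp, hωf]
          fin_cases b <;> simp [e12, signPair]
        · have hωt : ω = true := by rw [hω_def, decide_eq_true_eq, hm]
          rw [hm, hωt]
          fin_cases b <;> simp [e12, signPair]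
    refine ncard_fixed_diagonal_eq_of_exists_norm σ ϖ (d := fun j => if sb b j then c else (1 : K)) (d' := d) (fun j => ?_) _ T hT t
    obtain ⟨z, hz0, hz⟩ := exists_rep_of_dichotomy σ hσc hc0 hdich (hσd j) (hd0 j)
    refine ⟨z, hz0, ?_⟩
    by_cases hs : sb b j = true
    · rw [if_pos ((hsign j).2 hs)] at hz
      simpa [hs] using hz
    · have hns : ¬ normSign σ (d j) = -1 := fun h => hs ((hsign j).1 h)
      rw [if_neg hns] at hz
      simpa [hs] using hz
  -- (B) each class has the count of its complement
  have hB : ∀ b : Fin 4, C (sb b) = C (fun j => !(sb b j)) := fun b =>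
    ncard_fixed_signClass_eq_compl σ ϖ hσc hvc (sb b) _ T hT t
  -- (C) `κ_i(b) = χ_i(sb b) = χ_i(¬ sb b)`
  have hκ : ∀ b : Fin 4, kappaChar i b = χ (sb b) ∧ kappaChar i b = χ (fun j => !(sb b j)) := by
    intro b
    have h := kappaChar_eq_chi_signClass ω i b
    rw [← hw] at h
    exact h
  -- bookkeeping
  calc 2 * ∑ b : Fin 4, kappaChar i b * (fixedVertexCount σ ϖ t (Γ b) : ℤ)
      = ∑ b : Fin 4, χ (sb b) * (C (sb b) : ℤ) + ∑ b : Fin 4, χ (fun j => !(sb b j)) * (C (fun j => !(sb b j)) : ℤ) := by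
        rw [two_mul, ← Finset.sum_add_distrib, ← Finset.sum_add_distrib]
        refine Finset.sum_congr rfl fun b _ => ?_
        rw [hA b, ← (hκ b).1, ← (hκ b).2, ← hB b]
    _ = ∑ s : Fin 3 → Bool, χ s * (C s : ℤ) := (sum_signClasses_eq_sum_add_sum ω (fun s => χ s * (C s : ℤ))).symm

end Head

end Summit.HodgeConjecture.HodgeConjecture.Cruxes.H413.F0P3cDyRamKappaSumSignClasses

end
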